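/-
Copyright: public-domain mathematics; formalisation produced inside the b2b autopsy cell `lwe-quantum-autopsy`
(Part 1, generation 16).  Source analysed: Yilei Chen, "Quantum Algorithms for Lattice Problems",
IACR ePrint 2024/555, version of 2024-04-18 (WITHDRAWN by the author: "Step 9 of the algorithm contains a
bug, which I don't know how to fix").  Bib key `ChenQuantumLattice2024`.
REPRODUCTION / ANALYSIS OF A CLAIMED RESULT UNDER ADJUDICATION (withdrawn).
-/
import Literature.Computability.Cryptography.ChenQuantumLWEStepEightReversal
import Literature.Computability.Cryptography.ChenQuantumLWEThresholdPrimeExact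

/-!
# Chen (2024), §3.5.8 in one theorem: Step 8 is sound as printed, and certifies `v′₁ mod D²p₁` only

REPRODUCTION / ANALYSIS OF A CLAIMED RESULT UNDER ADJUDICATION (withdrawn).  HONEST FRAMING: this module
only ASSEMBLES, by name, the kernel-checked verdict on Step 8 of Chen's withdrawn quantum LWE algorithm from
the modules (N) `ChenQuantumLWEStepEight` (Claim 3.14), (AA) `ChenQuantumLWEStepEightReversal`
(Lemma 3.13: the fifth operation is sure and non-demolition, the four operations reverse exactly),
(Y)/(Z) `ChenQuantumLWEThresholdOrder` / `ChenQuantumLWEThresholdLargestPrime` (the measurement ceiling at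
tolerance `Θ(1/𝔭(Q)²)` for every admissible `Q`) and (AC) `ChenQuantumLWEThresholdPrimeExact` (the exact
threshold `1/(Q² + 1)` for prime `Q ≥ 13`), and records the two corollaries of (AC) at the exact threshold.
The value is a THEOREM about a WITHDRAWN algorithm (a precise negative result) — NOT progress on LWE, on any
lattice problem or on quantum advantage; it repairs nothing and breaks nothing.  The bug of the paper is the
false premise of Lemma 2.17 invoked in Step 9 (modules `ChenQuantumLWEStepNine`, `ChenQuantumLWEHonestStepNine`,
`ChenQuantumLWEEq41Exact`), untouched here.

* `Shape.shiftV` — the instance `(b, v′ + 2D²p₁b)` used throughout gens 6–16: admissible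
  (`shiftV_admissible`), same `step8Output = v′₁ mod D²p₁` (`step8Output_shiftV`), different
  `step9Needs = v′₁ mod D²P` (`step9Needs_shiftV_ne`) — the three facts every ceiling module re-derived inline.
* `Shape.step8_verdict` — Claim 3.14 ∧ Lemma 3.13 ∧ (ceiling at `32ε𝔭(Q)² ≤ 1`, failure at `1/p²` for
  every prime `p ∣ Q`) ∧ (prime `Q ≥ 13` ⇒ ceiling iff `ε < 1/(Q² + 1)`).
* `Shape.step8_cannot_supply_step9Needs_povm_prime`, `Shape.step9Needs_not_almostSurely_measurable_prime` —
  (Z)'s Step-9 corollaries at the exact prime threshold `ε·(Q² + 1) < 1` (there: `32εQ² ≤ 1`).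

Paper indexing `v′₁`, `w₁` = Lean index `0`.  [cite: ChenQuantumLattice2024, §3.5.8 pp. 32–34
(Lemma 3.13 p. 32, Claim 3.14 p. 33, fifth operation and reversal p. 34), eq. (35) p. 31, §3.5.9 p. 37;
NielsenChuang2010, §2.2.6 p. 90]
-/

open scoped BigOperators ComplexOrder MatrixOrder
open Matrix Finset

namespace Literature.Computability.Cryptography.Chen2024

namespace Shape

variable (S : Shape)

/-- The planted vector of the comparison instance `(b, v′ + 2D²p₁b)`: same slopes `b`, `v′` shifted by
`2D²p₁·b`. [cite: ChenQuantumLattice2024, §3.5.8 pp. 33–34, §3.5.9 p. 37] -/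
def shiftV : Fin (S.n + 1) → ℤ := fun i => S.v' i + 2 * (S.D : ℤ) * S.D * S.p₁ * S.b i

/-- `shiftV` unfolds to the expression used in (P)–(AC). [folklore] -/
theorem shiftV_eq : S.shiftV = fun i => S.v' i + 2 * (S.D : ℤ) * S.D * S.p₁ * S.b i := rfl

/-- The comparison instance is admissible (Chen's C.1–C.3). [cite: ChenQuantumLattice2024, Cond. C.1–C.3 p. 18] -/
theorem shiftV_admissible (h : S.Admissible) : (S.inst S.b S.shiftV).Admissible :=
  S.inst_admissible h h.b_head h.b_tail fun i => by
    show (S.D : ℤ) ∣ S.v' i + 2 * (S.D : ℤ) * S.D * S.p₁ * S.b i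
    exact dvd_add (h.v'_in_DZ i) ⟨2 * S.D * S.p₁ * S.b i, by ring⟩

/-- The comparison instance has the SAME Step-8 output `v′₁ mod D²p₁` (`b₁ = −1`).
[cite: ChenQuantumLattice2024, Lemma 3.13 p. 32] -/
theorem step8Output_shiftV (h : S.Admissible) : (S.inst S.b S.shiftV).step8Output = S.step8Output := by
  show (((S.v' 0 + 2 * (S.D : ℤ) * S.D * S.p₁ * S.b 0 : ℤ)) : ZMod ((S.D : ℕ) ^ 2 * S.p₁))
      = ((S.v' 0 : ℤ) : ZMod ((S.D : ℕ) ^ 2 * S.p₁))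
  rw [ZMod.intCast_eq_intCast_iff_dvd_sub, h.b_head]
  exact ⟨2, by push_cast; ring⟩

/-- The comparison instance has a DIFFERENT Step-9 requirement `v′₁ mod D²P` (`Q ≥ 3`).
[cite: ChenQuantumLattice2024, §3.5.9 p. 37] -/
theorem step9Needs_shiftV_ne (h : S.Admissible) : (S.inst S.b S.shiftV).step9Needs ≠ S.step9Needs := by
  show (((S.v' 0 + 2 * (S.D : ℤ) * S.D * S.p₁ * S.b 0 : ℤ)) : ZMod S.N) ≠ ((S.v' 0 : ℤ) : ZMod S.N)
  rw [Ne, ZMod.intCast_eq_intCast_iff_dvd_sub, h.b_head, S.N_coe, S.P_coe]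
  rintro ⟨c, hc⟩
  have hD : (0 : ℤ) < S.D := by exact_mod_cast S.D.pos
  have hp : (0 : ℤ) < S.p₁ := by exact_mod_cast S.p₁.pos
  have hQ3 : (3 : ℤ) ≤ S.Q := by exact_mod_cast h.three_le_Q
  have hc' : (S.D : ℤ) * S.D * S.p₁ * (2 - S.Q * c) = 0 := by linear_combination hc
  have h2 : (2 : ℤ) - S.Q * c = 0 := by
    rcases mul_eq_zero.1 hc' with h1 | h1
    · exfalso
      have : (0 : ℤ) < (S.D : ℤ) * S.D * S.p₁ := by positivity
      exact this.ne' h1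
    · exact h1
  have : (S.Q : ℤ) * c = 2 := by linarith
  rcases lt_trichotomy c 0 with hc0 | hc0 | hc0
  · nlinarith
  · rw [hc0, mul_zero] at this
    norm_num at this
  · nlinarith

/-- **§3.5.8 of the withdrawn paper, kernel-checked, in one statement** (every admissible shape `S`, any set
`U` of unknown coordinates):
(1) CLAIM 3.14 holds for `|φ7.d⟩` ((N) `claim314_phi7d`);
(2) LEMMA 3.13: the fifth operation is sure with value `read8Value = v′₁/D mod Dp₁` and does not disturb
    `|φ7.d⟩`, the digit read times `D` is `step8Output = v′₁ mod D²p₁`, and the four operations reverse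
    `|φ7.d⟩` to `|φ7⟩` up to a non-zero scalar ((AA) `lemma313`);
(3) the MEASUREMENT CEILING at the sharp order: every POVM on the Step-8 register that is `ε`-almost sure on
    the class `InClass U` (`t₁+1 ∈ U`) with `32ε·p² ≤ 1` for all primes `p ∣ Q` gives `S` and the comparison
    instance `(b, shiftV)` — same `step8Output`, different `step9Needs` — the same almost-certain outcome,
    and this fails at `ε = 1/p²` for every prime `p ∣ Q` ((Z) `step8_povm_ceiling_order`);
(4) for PRIME `Q ≥ 13` the threshold is EXACT: ceiling for `ε·(Q² + 1) < 1`, failure at `ε = 1/(Q² + 1)`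
    ((AC) `step8_povm_ceiling_threshold_prime`).
So Step 8 does exactly what Lemma 3.13 says and certifies `v′₁ mod D²p₁`, never the `v′₁ mod D²P` that
Step 9 consumes.  Adjudication, not a claim of the source beyond (1)–(2); HONEST FRAMING: a theorem about a
WITHDRAWN algorithm. [cite: ChenQuantumLattice2024, Lemma 3.13 p. 32, Claim 3.14 p. 33, p. 34, §3.5.9 p. 37;
NielsenChuang2010, §2.2.6 p. 90] -/
theorem step8_verdict (h : S.Admissible) (U : Finset (Fin (S.n + 1))) :
    S.Claim314 S.phi7d
    ∧ ((∀ r, S.fifthOp r S.phi7d = if r = S.read8Value then S.phi7d else 0)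
        ∧ S.step8Output = ((((S.D : ℕ) * S.read8Value.val : ℕ)) : ZMod ((S.D : ℕ) ^ 2 * S.p₁))
        ∧ ∃ c : ℂ, c ≠ 0 ∧ S.reverse8 (S.fifthOp S.read8Value S.phi7d) = c • S.phi7)
    ∧ ((S.inst S.b S.shiftV).Admissible ∧ (S.inst S.b S.shiftV).step8Output = S.step8Output
        ∧ (S.inst S.b S.shiftV).step9Needs ≠ S.step9Needs)
    ∧ ((∀ {κ : Type} [Fintype κ] [DecidableEq κ] (t₁ : Fin S.n), t₁.succ ∈ U →
          ∀ (E : POVM (Fin (S.n + 1) → ZMod S.M) κ) {ε : ℝ},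
            (∀ p ∈ (S.Q : ℕ).primeFactors, 32 * ε * (p : ℝ) ^ 2 ≤ 1) → S.AlmostSureOn ε U E →
              ∀ k k' : κ, E.AlmostCertain ε S.phi7d k →
                E.AlmostCertain ε (S.inst S.b S.shiftV).phi7d k' → k = k')
        ∧ ∀ p ∈ (S.Q : ℕ).primeFactors, ∃ (E : POVM (Fin (S.n + 1) → ZMod S.M) (Fin 2)) (k k' : Fin 2),
            S.AlmostSureOn (1 / (p : ℝ) ^ 2) U E ∧ k ≠ k'
            ∧ E.AlmostCertain (1 / (p : ℝ) ^ 2) S.phi7d k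
            ∧ E.AlmostCertain (1 / (p : ℝ) ^ 2) (S.inst S.b S.shiftV).phi7d k')
    ∧ ((S.Q : ℕ).Prime → 13 ≤ (S.Q : ℕ) →
        (∀ {κ : Type} [Fintype κ] [DecidableEq κ] (t₁ : Fin S.n), t₁.succ ∈ U →
            ∀ (E : POVM (Fin (S.n + 1) → ZMod S.M) κ) {ε : ℝ}, ε * (((S.Q : ℕ) : ℝ) ^ 2 + 1) < 1 →
              S.AlmostSureOn ε U E →
                ∀ k k' : κ, E.AlmostCertain ε S.phi7d k →
                  E.AlmostCertain ε (S.inst S.b S.shiftV).phi7d k' → k = k')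
        ∧ ∃ (E : POVM (Fin (S.n + 1) → ZMod S.M) (Fin 2)) (k k' : Fin 2),
            S.AlmostSureOn (1 / (((S.Q : ℕ) : ℝ) ^ 2 + 1)) U E ∧ k ≠ k'
            ∧ E.AlmostCertain (1 / (((S.Q : ℕ) : ℝ) ^ 2 + 1)) S.phi7d k
            ∧ E.AlmostCertain (1 / (((S.Q : ℕ) : ℝ) ^ 2 + 1)) (S.inst S.b S.shiftV).phi7d k') :=
  ⟨S.claim314_phi7d h, S.lemma313 h, ⟨S.shiftV_admissible h, S.step8Output_shiftV h, S.step9Needs_shiftV_ne h⟩,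
    S.step8_povm_ceiling_order h U, fun hQ h13 => S.step8_povm_ceiling_threshold_prime h hQ h13 U⟩

/-- **Corollary at the exact prime threshold (`Q` prime, `Q ≥ 13`, `ε·(Q² + 1) < 1`): no measurement of the
Step-8 register supplies what Step 9 consumes, even approximately** — (Z)
`step8_cannot_supply_step9Needs_povm_largestPrime` (there `32εQ² ≤ 1`) up to the exact threshold: for any
unknown coordinates `U ∋ t₁+1` and any POVM `ε`-almost sure on the class, the admissible instance
`(b, shiftV)` — same `b`, same `step8Output`, DIFFERENT `step9Needs` — receives the same almost-certain
outcome as `S`.  HONEST FRAMING: about a WITHDRAWN algorithm; repairs nothing, breaks nothing.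
[cite: ChenQuantumLattice2024, Lemma 3.13 p. 32, §3.5.9 p. 37] -/
theorem step8_cannot_supply_step9Needs_povm_prime (h : S.Admissible) (hQ : (S.Q : ℕ).Prime)
    (h13 : 13 ≤ (S.Q : ℕ)) {κ : Type*} [Fintype κ] [DecidableEq κ] (U : Finset (Fin (S.n + 1)))
    (t₁ : Fin S.n) (ht₁ : t₁.succ ∈ U) (E : POVM (Fin (S.n + 1) → ZMod S.M) κ) {ε : ℝ}
    (hε : ε * (((S.Q : ℕ) : ℝ) ^ 2 + 1) < 1) (hE : S.AlmostSureOn ε U E) :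
    ∃ v₃ : Fin (S.n + 1) → ℤ, (S.inst S.b v₃).Admissible
      ∧ (S.inst S.b v₃).step8Output = S.step8Output
      ∧ (S.inst S.b v₃).step9Needs ≠ S.step9Needs
      ∧ ∀ k k' : κ, E.AlmostCertain ε S.phi7d k → E.AlmostCertain ε (S.inst S.b v₃).phi7d k' → k = k' :=
  ⟨S.shiftV, S.shiftV_admissible h, S.step8Output_shiftV h, S.step9Needs_shiftV_ne h,
    fun _ _ hk hk' => S.step8_povm_ceiling_prime h hQ h13 U t₁ ht₁ E hε hE hk hk'⟩

/-- **Corollary (`Q` prime `≥ 13`, `n ≥ 1`, `ε·(Q² + 1) < 1`): `step9Needs` cannot be read off `|φ7.d⟩`,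
even with error** — no POVM on the Step-8 register with outcomes in `ℤ_N` returns, on `|φ7.d⟩` of every
admissible instance, that instance's `step9Needs = v′₁ mod N` with weight `≥ (1 − ε)⟨φ7.d|φ7.d⟩`
((Z) `step9Needs_not_almostSurely_measurable_largestPrime` up to the exact threshold; by (R)
`Shape.step9Needs_not_almostCertain_third` the READ-OUT conclusion itself holds for every `ε ≤ 1/3` by an
averaging argument — recorded here as the measurement-ceiling route).  HONEST FRAMING: about a WITHDRAWN
algorithm. [cite: ChenQuantumLattice2024, Lemma 3.13 p. 32, §3.5 p. 22, §3.5.9 p. 37] -/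
theorem step9Needs_not_almostSurely_measurable_prime (h : S.Admissible) (hQ : (S.Q : ℕ).Prime)
    (h13 : 13 ≤ (S.Q : ℕ)) (hn : 0 < S.n) {ε : ℝ} (hε : ε * (((S.Q : ℕ) : ℝ) ^ 2 + 1) < 1)
    (E : POVM (Fin (S.n + 1) → ZMod S.M) (ZMod S.N)) :
    ¬ ∀ b₂ v₂ : Fin (S.n + 1) → ℤ, (S.inst b₂ v₂).Admissible →
        E.AlmostCertain ε (S.inst b₂ v₂).phi7d (S.inst b₂ v₂).step9Needs := by
  intro H
  have hE : S.AlmostSureOn ε Finset.univ E := fun b₂ v₂ hI => ⟨_, H b₂ v₂ hI.2⟩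
  obtain ⟨v₃, h₃, -, hne, hk⟩ :=
    S.step8_cannot_supply_step9Needs_povm_prime h hQ h13 Finset.univ ⟨0, hn⟩ (Finset.mem_univ _) E hε hE
  exact hne (hk _ _ (H S.b S.v' h) (H S.b v₃ h₃)).symm

end Shape

end Literature.Computability.Cryptography.Chen2024
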